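import Summits.NavierStokesRegularity.NavierStokesRegularity.Theorems.TypeIQuantSubcubicExp.Negative.ThinCascadeLiouvilleImpliesFDL
import Summits.NavierStokesRegularity.NavierStokesRegularity.Theorems.TypeIQuantSubcubicExp.Negative.SwirlThinEstimates
import HarnessLib

/-!
# Stub S3 `stub_thinCascadeLiouville` (stmt-NavierStokesRegularity-24077, line `thin_cascade`):
# the Oseen/KNSS gauge is LOAD-BEARING — the decaying swirl inhabits the gauge-free thin-object class

Refuter-side negative-lane file (seat ns-afl-r1 g7, `--supports stmt-NavierStokesRegularity-24077`).
Navier–Stokes regularity is NOT proved by anything here; no summit statement is; S3 and 24077 stay OPEN.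

S3 reads `∀ M q v g, ¬ ThinObject M q v g`, where `ThinObject` asks for a Type-I ancient mild field
`v` in the KNSS gauge (`IsTypeIAncientMild M v` = jointly smooth on the open past ∧ divergence-free
slices ∧ **the Oseen integral equation between every pair of negative times** ∧ `‖v(t,x)‖ ≤ M/√(−t)`)
with uniform unit-scale energy up to the apex, singular at the origin, with a locally integrable weak
trace `g` at `t = 0` of thin annular cube budget `∫_{1<|x|<R} |g|³ ≤ q (1 + log R)`.

The witness is the tree's decaying self-similar swirl of the `SymmetricLiouville` negative lane,
`swirlScaled ε t x = ε Jx/(‖x‖² − t)` (`RssFarFieldLoadBearing`: jointly smooth, divergence free,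
Type-I with constant `ε`), with trace its own `t = 0` slice `ε Jx/‖x‖²`; its unit-scale energy,
singular apex, trace and backward self-similarity are in `Negative/SwirlThinEstimates.lean`. Results:

* `thinCascadeLiouville_false_without_gauge`, `thinObject_without_gauge_inhabited` — **drop the Oseen
  integral equation and S3 is false at EVERY admissible parameter**: for every `M > 0`, `q > 0`,
  with `ε = min(1, M, q/(3|B₁|+1))`, the pair `(swirlScaled ε, swirlScaled ε 0)` satisfies every other
  clause of `ThinObject M q · ·` verbatim (`swirlScaled_thinObject_clauses`): joint smoothness on
  `t < 0`, `div = 0`, the Type-I bound, uniform local energy `∫_{B(x₀,1)}|v(t)|² ≤ ∫_{B₁}|y|⁻² + |B₁|`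
  (`|v| ≤ 1/|x|`), singular at the origin (`|v(−ρ², ρf₀)| = ε/(2ρ)`), trace in `L¹_loc`
  (`|g| ≤ ε/|x|`), the weak trace for every smooth compactly supported test (dominated convergence,
  majorant `ε|φ|/|x|`), and the budget from `∫_{1<|x|<R}|x|⁻³ = 3|B₁| log R`, `3|B₁|ε³ ≤ q`.
  So any proof of S3 must use the gauge.
* `thinObject_without_gauge_selfSimilar_member`, `isSelfSimilar_swirlScaled` — that member is
  backward SELF-SIMILAR with Type-I constant `ε ≤ 1` (and `< 1` whenever `M < 1`): the landed rungs
  `ThinCascade.thinObject_not_selfSimilar` (p631569) and `ThinCascade.not_thinObject_of_lt_one`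
  (`M < 1`, p626481) are theorems OF THE GAUGE.
* `thinObject_clauses_rest_state`, `not_singularAt_zero` — sanity: the rest state `(0,0)` satisfies
  every clause of `ThinObject M q` (gauge included) except `SingularAt v 0` (`M ≥ 0`, any `q`).

READING (numbers, not adjectives): LQD's gauge-free witnesses for crux 22144 — slice-constant drifts
`c(t)`, `|c(t)| = (−t)^{-1/2}` (`FiniteDissipationLiouville/Negative/GaugeLoadBearing.lean`, p578948) —
do NOT inhabit the gauge-free thin-object class: `∫_{B₁}|c(t)|² = |B₁|/(−t)` violates the uniform
energy clause.  The thin class needs a spatially decaying singular witness; the swirl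
(`|v| ≤ min(ε/√(−t), ε/|x|)`) is one at every `(M,q) ∈ (0,∞)²`.  What the gauge must exclude for S3
is thus the family of singular self-similar divergence-free Type-I profiles with finite uniform local
energy — for the swirl the Oseen equation indeed fails (`∂ₜv − Δv + (v·∇)v` is not a gradient).
Nothing here bears on the truth of S3.  Standard axioms only.
-/

noncomputable section

-- the summit and its single sub-problem share the name (CONVENTIONS §1), as in every Theorems file
set_option linter.dupNamespace false

namespace Summit.NavierStokesRegularity.NavierStokesRegularity.Theorems.TypeIQuantSubcubicExp.Negative

open MeasureTheory Set Filter Topology Metric Function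
open Literature.Analysis Literature.Analysis.FluidPDE
open Summit.NavierStokesRegularity.NavierStokesRegularity.Cruxes.TypeIQuantSubcubicExp.ThinCascade
open Summit.NavierStokesRegularity.NavierStokesRegularity.Theorems.SymmetricLiouville.Negative
open scoped ENNReal NNReal RealInnerProductSpace

/-! ### The gauge is load-bearing -/

/-- **The scaled swirl inhabits the gauge-free thin-object class.**  For `0 < ε ≤ 1`, `ε ≤ M` and
`3|B₁|ε³ ≤ q`, the pair `(swirlScaled ε, swirlScaled ε 0)` satisfies every clause of `ThinObject M q`
except the Oseen integral equation: the three other conjuncts of `IsTypeIAncientMild M` (joint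
smoothness on the open past, divergence-free slices, `HasTypeITimeDecay M`) and clauses (2)–(6)
verbatim. -/
theorem swirlScaled_thinObject_clauses {M q ε : ℝ} (hε : 0 < ε) (hε1 : ε ≤ 1) (hεM : ε ≤ M)
    (hεq : 3 * (volume : Measure (EuclideanSpace ℝ (Fin 3))).real (ball 0 1) * ε ^ 3 ≤ q) :
    (ContDiffOn ℝ (⊤ : ℕ∞) (uncurry (swirlScaled ε)) (Iio 0 ×ˢ univ) ∧
      (∀ t < 0, VectorCalculus.IsDivFree (swirlScaled ε t)) ∧ HasTypeITimeDecay M (swirlScaled ε)) ∧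
    (∃ E : ℝ, ∀ x₀ : EuclideanSpace ℝ (Fin 3), ∀ t ∈ Set.Ioo (-1 : ℝ) 0,
      ∫⁻ y in Metric.ball x₀ 1, ENNReal.ofReal (‖swirlScaled ε t y‖ ^ 2) ≤ ENNReal.ofReal E) ∧
    SingularAt (swirlScaled ε) 0 ∧
    LocallyIntegrable (swirlScaled ε 0) volume ∧
    (∀ φ : EuclideanSpace ℝ (Fin 3) → EuclideanSpace ℝ (Fin 3), ContDiff ℝ (⊤ : ℕ∞) φ →
      HasCompactSupport φ →
      Filter.Tendsto (fun t => ∫ x, inner ℝ (swirlScaled ε t x) (φ x)) (nhdsWithin 0 (Set.Iio 0))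
        (nhds (∫ x, inner ℝ (swirlScaled ε 0 x) (φ x)))) ∧
    ∀ R : ℝ, 1 ≤ R →
      ∫⁻ x in {x : EuclideanSpace ℝ (Fin 3) | 1 < ‖x‖ ∧ ‖x‖ < R}, ENNReal.ofReal (‖swirlScaled ε 0 x‖ ^ 3)
        ≤ ENNReal.ofReal (q * (1 + Real.log R)) := by
  have hε0 : 0 ≤ ε := hε.le
  have hcB0 : 0 ≤ 3 * (volume : Measure (EuclideanSpace ℝ (Fin 3))).real (ball 0 1) :=
    NewtonPotentialHolder.three_mul_volume_real_ball_nonneg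
  -- the envelopes of the scaled witness
  have hdec : ∀ t ≤ 0, ∀ x : EuclideanSpace ℝ (Fin 3), x ≠ 0 → ‖swirlScaled ε t x‖ ≤ ε / ‖x‖ :=
      fun t ht x hx => by
    rw [swirlScaled_apply, norm_smul, Real.norm_eq_abs, abs_of_pos hε, div_eq_mul_one_div]
    exact mul_le_mul_of_nonneg_left (norm_swirlField_le_inv ht hx) hε0
  have henv : ∀ x : EuclideanSpace ℝ (Fin 3), x ≠ 0 → ‖swirlScaled ε 0 x‖ ≤ ε / ‖x‖ :=
    fun x hx => hdec 0 le_rfl x hx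
  have henv' : ∀ x : EuclideanSpace ℝ (Fin 3), x ≠ 0 → ‖swirlScaled ε 0 x‖ ≤ ε * ‖x‖ ^ (-1 : ℝ) := fun x hx => by
    rw [Real.rpow_neg_one, ← div_eq_mul_inv]; exact henv x hx
  have hmeas : AEStronglyMeasurable (swirlScaled ε 0) (volume : Measure (EuclideanSpace ℝ (Fin 3))) :=
    (measurable_swirlField_zero.const_smul ε).aestronglyMeasurable
  refine ⟨⟨?_, ?_, ?_⟩, ?_, ?_, ?_, ?_, ?_⟩
  · -- (1a) joint smoothness on the open past
    exact swirlScaled_smooth ε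
  · -- (1b) divergence-free slices
    intro t ht
    exact swirlScaled_divFree ε ht
  · -- (1d) the Type-I bound, constant `ε ≤ M`
    intro t ht x
    exact (swirlScaled_typeI hε0 t ht x).trans (div_le_div_of_nonneg_right hεM (Real.sqrt_nonneg _))
  · -- (2) uniform unit-scale energy up to the apex
    set I : ℝ≥0∞ := (∫⁻ y in ball (0 : EuclideanSpace ℝ (Fin 3)) 1, ENNReal.ofReal (‖y‖ ^ (-2 : ℝ))) +
      volume (ball (0 : EuclideanSpace ℝ (Fin 3)) 1) with hI
    have hItop : I ≠ ⊤ :=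
      ENNReal.add_ne_top.2 ⟨lintegral_ball_rpow_neg_two_lt_top.ne, measure_ball_lt_top.ne⟩
    refine ⟨I.toReal, fun x₀ t ht => ?_⟩
    rw [ENNReal.ofReal_toReal hItop]
    have ht0 : t < 0 := ht.2
    calc ∫⁻ y in ball x₀ 1, ENNReal.ofReal (‖swirlScaled ε t y‖ ^ 2)
        ≤ ∫⁻ y in ball x₀ 1, ENNReal.ofReal (‖swirlField t y‖ ^ 2) := by
          refine lintegral_mono fun y => ENNReal.ofReal_le_ofReal ?_
          rw [swirlScaled_apply, norm_smul, Real.norm_eq_abs, abs_of_pos hε, mul_pow]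
          have h1 : ε ^ 2 ≤ 1 := pow_le_one₀ hε0 hε1
          nlinarith [sq_nonneg ‖swirlField t y‖]
      _ ≤ I := lintegral_ball_sq_swirlField_le ht0.le x₀
  · -- (3) singular at the origin: `|ε v(−ρ², ρ f₀)| = ε/(2ρ)`
    intro r hr A
    set ρ : ℝ := min (r / 2) (ε / (2 * (|A| + 1))) with hρ
    have hA1 : 0 < |A| + 1 := by positivity
    have hρpos : 0 < ρ := lt_min (by positivity) (by positivity)
    have hρr : ρ < r := (min_le_left _ _).trans_lt (by linarith)
    have hρA : ρ ≤ ε / (2 * (|A| + 1)) := min_le_right _ _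
    refine ⟨-(ρ ^ 2), ⟨by nlinarith, by nlinarith⟩, ρ • f0, ?_, ?_⟩
    · rw [mem_ball_zero_iff, norm_smul, norm_f0, mul_one, Real.norm_eq_abs, abs_of_pos hρpos]
      exact hρr
    · rw [swirlScaled_apply, norm_smul, Real.norm_eq_abs, abs_of_pos hε, norm_swirlField_axis hρpos]
      have h2ρ : 0 < 2 * ρ := by positivity
      have hkey : (|A| + 1) * (2 * ρ) ≤ ε := by
        have := (le_div_iff₀ (by positivity : (0 : ℝ) < 2 * (|A| + 1))).1 hρA
        linarith
      calc A ≤ |A| := le_abs_self A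
        _ < |A| + 1 := lt_add_one _
        _ ≤ ε / (2 * ρ) := (le_div_iff₀ h2ρ).2 hkey
        _ = ε * (2 * ρ)⁻¹ := div_eq_mul_inv _ _
  · -- (4) the trace is locally integrable: `|ε g| ≤ ε/|x|`
    rw [locallyIntegrable_iff]
    intro S hS
    obtain ⟨R, hR⟩ := hS.isBounded.subset_ball 0
    refine IntegrableOn.mono_set ?_ hR
    have hint : IntegrableOn (fun x : EuclideanSpace ℝ (Fin 3) => ‖x‖ ^ (-1 : ℝ))
        (ball (0 : EuclideanSpace ℝ (Fin 3)) R) :=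
      PDE.Newtonian.integrableOn_ball_norm_rpow_neg (E := EuclideanSpace ℝ (Fin 3))
        (by rw [finrank_euclideanSpace_fin]) (by rw [finrank_euclideanSpace_fin]; norm_num) R
    refine Integrable.mono' (hint.const_mul ε) hmeas.restrict ?_
    filter_upwards [ae_restrict_of_ae (s := ball (0 : EuclideanSpace ℝ (Fin 3)) R) ae_ne_zero] with x hx
    exact henv' x hx
  · -- (5) the weak trace at the apex, for every test field (dominated convergence)
    intro φ hφ hφc
    have hφcont : Continuous φ := hφ.continuous
    obtain ⟨B, hB⟩ := hφcont.bounded_above_of_compact_support hφc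
    obtain ⟨R, hR⟩ := hφc.isCompact.isBounded.subset_ball (0 : EuclideanSpace ℝ (Fin 3))
    have hev : ∀ᶠ t in 𝓝[<] (0 : ℝ), t < 0 := eventually_mem_nhdsWithin
    refine tendsto_integral_filter_of_dominated_convergence
      (fun x => ε * ‖φ x‖ * ‖x‖ ^ (-1 : ℝ)) ?_ ?_ ?_ ?_
    · filter_upwards [hev] with t ht
      have hc : Continuous (swirlScaled ε t) := ((continuous_iff_continuousAt.2 fun x =>
        (hasFDerivAt_swirlField ht x).continuousAt).const_smul ε :)
      exact (hc.inner hφcont).aestronglyMeasurable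
    · filter_upwards [hev] with t ht
      filter_upwards [ae_ne_zero] with x hx
      calc ‖⟪swirlScaled ε t x, φ x⟫‖ ≤ ‖swirlScaled ε t x‖ * ‖φ x‖ := norm_inner_le_norm _ _
        _ ≤ ε / ‖x‖ * ‖φ x‖ := mul_le_mul_of_nonneg_right (hdec t ht.le x hx) (norm_nonneg _)
        _ = ε * ‖φ x‖ * ‖x‖ ^ (-1 : ℝ) := by rw [Real.rpow_neg_one, div_eq_mul_inv]; ring
    · refine integrable_mul_norm_rpow_neg_one (ψ := fun x => ε * ‖φ x‖)
        (continuous_const.mul hφcont.norm).aestronglyMeasurable (B := |ε| * B) (fun x => ?_)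
        (R := R) (fun x hx => ?_)
      · rw [norm_mul, Real.norm_eq_abs, norm_norm]
        exact mul_le_mul_of_nonneg_left (hB x) (abs_nonneg ε)
      · have hφx : φ x ≠ 0 := fun h => hx (by simp [h])
        exact mem_ball_zero_iff.1 (hR (subset_tsupport φ (mem_support.2 hφx)))
    · filter_upwards [ae_ne_zero] with x hx
      exact ((tendsto_swirlField_zero hx).const_smul ε).inner tendsto_const_nhds
  · -- (6) the thin annulus budget: `|ε g|³ ≤ ε³|x|⁻³`, `∫_{1<|x|<R} |x|⁻³ = 3|B₁| log R`, `3|B₁|ε³ ≤ q`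
    intro R hR1
    have hA3 : 0 ≤ ε ^ 3 := pow_nonneg hε0 3
    have hsub : {x : EuclideanSpace ℝ (Fin 3) | 1 < ‖x‖ ∧ ‖x‖ < R} ⊆ ball (0 : EuclideanSpace ℝ (Fin 3)) R \ ball 0 1 := by
      intro x hx
      refine ⟨mem_ball_zero_iff.2 hx.2, fun h => ?_⟩
      rw [mem_ball_zero_iff] at h
      linarith [hx.1]
    have hmeasS : MeasurableSet {x : EuclideanSpace ℝ (Fin 3) | 1 < ‖x‖ ∧ ‖x‖ < R} :=
      (measurableSet_lt measurable_const measurable_norm).inter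
        (measurableSet_lt measurable_norm measurable_const)
    calc ∫⁻ x in {x : EuclideanSpace ℝ (Fin 3) | 1 < ‖x‖ ∧ ‖x‖ < R}, ENNReal.ofReal (‖swirlScaled ε 0 x‖ ^ 3)
        ≤ ∫⁻ x in {x : EuclideanSpace ℝ (Fin 3) | 1 < ‖x‖ ∧ ‖x‖ < R}, ENNReal.ofReal (ε ^ 3 * ‖x‖ ^ (-3 : ℝ)) := by
          refine setLIntegral_mono' hmeasS fun x hx => ENNReal.ofReal_le_ofReal ?_
          have hxpos : 0 < ‖x‖ := by linarith [hx.1]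
          have hx0 : x ≠ 0 := norm_pos_iff.1 hxpos
          have e3 : ‖x‖ ^ (-3 : ℝ) = (‖x‖ ^ 3)⁻¹ := by
            rw [Real.rpow_neg (norm_nonneg _)]
            norm_num
          calc ‖swirlScaled ε 0 x‖ ^ 3 ≤ (ε / ‖x‖) ^ 3 :=
              pow_le_pow_left₀ (norm_nonneg _) (henv x hx0) 3
            _ = ε ^ 3 * ‖x‖ ^ (-3 : ℝ) := by rw [e3, div_pow, div_eq_mul_inv]
      _ ≤ ∫⁻ x in ball (0 : EuclideanSpace ℝ (Fin 3)) R \ ball 0 1, ENNReal.ofReal (ε ^ 3 * ‖x‖ ^ (-3 : ℝ)) :=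
          lintegral_mono_set hsub
      _ = ENNReal.ofReal (ε ^ 3) *
            ∫⁻ x in ball (0 : EuclideanSpace ℝ (Fin 3)) R \ ball 0 1, ENNReal.ofReal (‖x‖ ^ (-3 : ℝ)) := by
          rw [← lintegral_const_mul' _ _ ENNReal.ofReal_ne_top]
          exact lintegral_congr fun x => ENNReal.ofReal_mul hA3
      _ = ENNReal.ofReal (ε ^ 3) * ENNReal.ofReal
            (3 * (volume : Measure (EuclideanSpace ℝ (Fin 3))).real (ball 0 1) * Real.log (R / 1)) := by
          rw [NewtonPotentialHolder.lintegral_annulus_norm_rpow_neg_three one_pos hR1]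
      _ = ENNReal.ofReal (ε ^ 3 * (3 * (volume : Measure (EuclideanSpace ℝ (Fin 3))).real (ball 0 1) * Real.log R)) := by
          rw [div_one, ← ENNReal.ofReal_mul hA3]
      _ ≤ ENNReal.ofReal (q * (1 + Real.log R)) := by
          refine ENNReal.ofReal_le_ofReal ?_
          have hlog : 0 ≤ Real.log R := Real.log_nonneg hR1
          have hq0 : 0 ≤ q := le_trans (mul_nonneg hcB0 hA3) hεq
          nlinarith [mul_nonneg hcB0 hA3, mul_le_mul_of_nonneg_right hεq hlog]

/-- **The gauge-free thin-object class has a backward SELF-SIMILAR member at every `M > 0`, `q > 0`**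
(the scaled swirl `swirlScaled ε`, `ε = min(1, M, q/(3|B₁|+1))`, Type-I constant `ε ≤ M` — so for
`M < 1` a member with constant `< 1`): the `M < 1` rung `ThinCascade.not_thinObject_of_lt_one` and the
self-similar exclusion `ThinCascade.thinObject_not_selfSimilar` for genuine thin objects are theorems
OF THE GAUGE. -/
theorem thinObject_without_gauge_selfSimilar_member {M q : ℝ} (hM : 0 < M) (hq : 0 < q) :
    ∃ (v : ℝ → EuclideanSpace ℝ (Fin 3) → EuclideanSpace ℝ (Fin 3)) (g : EuclideanSpace ℝ (Fin 3) → EuclideanSpace ℝ (Fin 3)), IsSelfSimilar v ∧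
      (ContDiffOn ℝ (⊤ : ℕ∞) (uncurry v) (Iio 0 ×ˢ univ) ∧
        (∀ t < 0, VectorCalculus.IsDivFree (v t)) ∧ HasTypeITimeDecay M v) ∧
      (∃ E : ℝ, ∀ x₀ : EuclideanSpace ℝ (Fin 3), ∀ t ∈ Set.Ioo (-1 : ℝ) 0,
        ∫⁻ y in Metric.ball x₀ 1, ENNReal.ofReal (‖v t y‖ ^ 2) ≤ ENNReal.ofReal E) ∧
      SingularAt v 0 ∧
      LocallyIntegrable g volume ∧
      (∀ φ : EuclideanSpace ℝ (Fin 3) → EuclideanSpace ℝ (Fin 3), ContDiff ℝ (⊤ : ℕ∞) φ → HasCompactSupport φ →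
        Filter.Tendsto (fun t => ∫ x, inner ℝ (v t x) (φ x)) (nhdsWithin 0 (Set.Iio 0))
          (nhds (∫ x, inner ℝ (g x) (φ x)))) ∧
      ∀ R : ℝ, 1 ≤ R →
        ∫⁻ x in {x : EuclideanSpace ℝ (Fin 3) | 1 < ‖x‖ ∧ ‖x‖ < R}, ENNReal.ofReal (‖g x‖ ^ 3)
          ≤ ENNReal.ofReal (q * (1 + Real.log R)) := by
  have hcB0 : 0 ≤ 3 * (volume : Measure (EuclideanSpace ℝ (Fin 3))).real (ball 0 1) :=
    NewtonPotentialHolder.three_mul_volume_real_ball_nonneg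
  set V : ℝ := 3 * (volume : Measure (EuclideanSpace ℝ (Fin 3))).real (ball 0 1) with hV
  set ε : ℝ := min 1 (min M (q / (V + 1))) with hε
  have hV1 : 0 < V + 1 := by linarith
  have hεpos : 0 < ε := lt_min one_pos (lt_min hM (div_pos hq hV1))
  have hε1 : ε ≤ 1 := min_le_left _ _
  have hεM : ε ≤ M := (min_le_right _ _).trans (min_le_left _ _)
  have hεq' : ε ≤ q / (V + 1) := (min_le_right _ _).trans (min_le_right _ _)
  have hεq : V * ε ^ 3 ≤ q := by
    have h3 : ε ^ 3 ≤ ε := by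
      calc ε ^ 3 = ε * (ε * ε) := by ring
        _ ≤ ε * (1 * 1) := by gcongr
        _ = ε := by ring
    have h4 : (V + 1) * ε ≤ q := by rwa [le_div_iff₀ hV1, mul_comm] at hεq'
    nlinarith [mul_le_mul_of_nonneg_left h3 hcB0]
  exact ⟨_, _, isSelfSimilar_swirlScaled ε, swirlScaled_thinObject_clauses hεpos hε1 hεM hεq⟩

/-- **The Oseen/KNSS gauge is load-bearing for S3, at every admissible parameter.**  For every
`M > 0` and every `q > 0` there is a pair `(v, g)` satisfying `ThinObject M q v g` with the Oseen
integral equation (conjunct 3 of `IsTypeIAncientMild M v`) deleted and everything else verbatim —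
the scaled swirl `swirlScaled ε`.  Any proof of `stub_thinCascadeLiouville` must use the gauge. -/
theorem thinObject_without_gauge_inhabited {M q : ℝ} (hM : 0 < M) (hq : 0 < q) :
    ∃ (v : ℝ → EuclideanSpace ℝ (Fin 3) → EuclideanSpace ℝ (Fin 3)) (g : EuclideanSpace ℝ (Fin 3) → EuclideanSpace ℝ (Fin 3)),
      (ContDiffOn ℝ (⊤ : ℕ∞) (uncurry v) (Iio 0 ×ˢ univ) ∧
        (∀ t < 0, VectorCalculus.IsDivFree (v t)) ∧ HasTypeITimeDecay M v) ∧
      (∃ E : ℝ, ∀ x₀ : EuclideanSpace ℝ (Fin 3), ∀ t ∈ Set.Ioo (-1 : ℝ) 0,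
        ∫⁻ y in Metric.ball x₀ 1, ENNReal.ofReal (‖v t y‖ ^ 2) ≤ ENNReal.ofReal E) ∧
      SingularAt v 0 ∧
      LocallyIntegrable g volume ∧
      (∀ φ : EuclideanSpace ℝ (Fin 3) → EuclideanSpace ℝ (Fin 3), ContDiff ℝ (⊤ : ℕ∞) φ → HasCompactSupport φ →
        Filter.Tendsto (fun t => ∫ x, inner ℝ (v t x) (φ x)) (nhdsWithin 0 (Set.Iio 0))
          (nhds (∫ x, inner ℝ (g x) (φ x)))) ∧
      ∀ R : ℝ, 1 ≤ R →
        ∫⁻ x in {x : EuclideanSpace ℝ (Fin 3) | 1 < ‖x‖ ∧ ‖x‖ < R}, ENNReal.ofReal (‖g x‖ ^ 3)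
          ≤ ENNReal.ofReal (q * (1 + Real.log R)) := by
  obtain ⟨v, g, -, h⟩ := thinObject_without_gauge_selfSimilar_member hM hq
  exact ⟨v, g, h⟩

/-- **S3 without the gauge is false.**  The statement `stub_thinCascadeLiouville` with the Oseen
integral equation dropped from `ThinObject` (joint smoothness, incompressibility, the Type-I bound,
uniform local energy, the singularity, the `L¹_loc` weak trace and the thin budget all kept) fails —
already at `(M, q) = (1, 1)`, and in fact at every `M > 0`, `q > 0`
(`thinObject_without_gauge_inhabited`). -/
theorem thinCascadeLiouville_false_without_gauge :
    ¬ (∀ (M q : ℝ) (v : ℝ → EuclideanSpace ℝ (Fin 3) → EuclideanSpace ℝ (Fin 3)) (g : EuclideanSpace ℝ (Fin 3) → EuclideanSpace ℝ (Fin 3)),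
        ¬ ((ContDiffOn ℝ (⊤ : ℕ∞) (uncurry v) (Iio 0 ×ˢ univ) ∧
              (∀ t < 0, VectorCalculus.IsDivFree (v t)) ∧ HasTypeITimeDecay M v) ∧
            (∃ E : ℝ, ∀ x₀ : EuclideanSpace ℝ (Fin 3), ∀ t ∈ Set.Ioo (-1 : ℝ) 0,
              ∫⁻ y in Metric.ball x₀ 1, ENNReal.ofReal (‖v t y‖ ^ 2) ≤ ENNReal.ofReal E) ∧
            SingularAt v 0 ∧
            LocallyIntegrable g volume ∧
            (∀ φ : EuclideanSpace ℝ (Fin 3) → EuclideanSpace ℝ (Fin 3), ContDiff ℝ (⊤ : ℕ∞) φ → HasCompactSupport φ →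
              Filter.Tendsto (fun t => ∫ x, inner ℝ (v t x) (φ x)) (nhdsWithin 0 (Set.Iio 0))
                (nhds (∫ x, inner ℝ (g x) (φ x)))) ∧
            ∀ R : ℝ, 1 ≤ R →
              ∫⁻ x in {x : EuclideanSpace ℝ (Fin 3) | 1 < ‖x‖ ∧ ‖x‖ < R}, ENNReal.ofReal (‖g x‖ ^ 3)
                ≤ ENNReal.ofReal (q * (1 + Real.log R)))) := by
  intro h
  obtain ⟨v, g, hvg⟩ := thinObject_without_gauge_inhabited (M := 1) (q := 1) one_pos one_pos
  exact h 1 1 v g hvg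

/-! ### Sanity: the class minus the singularity is inhabited by the rest state -/

/-- The rest state is not singular anywhere. -/
theorem not_singularAt_zero (a : EuclideanSpace ℝ (Fin 3)) : ¬ SingularAt (fun _ _ => (0 : EuclideanSpace ℝ (Fin 3))) a := by
  intro h
  obtain ⟨t, -, y, -, hy⟩ := h 1 one_pos 0
  simp at hy

/-- **Every clause of `ThinObject M q` except `SingularAt` holds for the rest state `(0, 0)`**, gauge
included (`isTypeIAncientMild_zero`), for all `M ≥ 0` and every `q` (the budget integrand vanishes):
the singularity clause is the only one excluding the trivial solution, and the hypotheses of S3 other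
than it are satisfiable. -/
theorem thinObject_clauses_rest_state {M : ℝ} (hM : 0 ≤ M) (q : ℝ) :
    IsTypeIAncientMild M (fun _ _ => (0 : EuclideanSpace ℝ (Fin 3))) ∧
      (∃ E : ℝ, ∀ x₀ : EuclideanSpace ℝ (Fin 3), ∀ t ∈ Set.Ioo (-1 : ℝ) 0,
        ∫⁻ y in Metric.ball x₀ 1, ENNReal.ofReal (‖(fun _ _ => (0 : EuclideanSpace ℝ (Fin 3))) t y‖ ^ 2) ≤ ENNReal.ofReal E) ∧
      LocallyIntegrable (fun _ => (0 : EuclideanSpace ℝ (Fin 3))) (volume : Measure (EuclideanSpace ℝ (Fin 3))) ∧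
      (∀ φ : EuclideanSpace ℝ (Fin 3) → EuclideanSpace ℝ (Fin 3), ContDiff ℝ (⊤ : ℕ∞) φ → HasCompactSupport φ →
        Filter.Tendsto (fun t => ∫ x, inner ℝ ((fun _ _ => (0 : EuclideanSpace ℝ (Fin 3))) t x) (φ x)) (nhdsWithin 0 (Set.Iio 0))
          (nhds (∫ x, inner ℝ ((fun _ => (0 : EuclideanSpace ℝ (Fin 3))) x) (φ x)))) ∧
      ∀ R : ℝ, 1 ≤ R →
        ∫⁻ x in {x : EuclideanSpace ℝ (Fin 3) | 1 < ‖x‖ ∧ ‖x‖ < R}, ENNReal.ofReal (‖(fun _ => (0 : EuclideanSpace ℝ (Fin 3))) x‖ ^ 3)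
          ≤ ENNReal.ofReal (q * (1 + Real.log R)) := by
  refine ⟨isTypeIAncientMild_zero hM, ⟨0, fun x₀ t ht => by simp⟩, locallyIntegrable_const 0,
    fun φ _ _ => tendsto_const_nhds, fun R hR => by simp⟩

end Summit.NavierStokesRegularity.NavierStokesRegularity.Theorems.TypeIQuantSubcubicExp.Negative

end
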